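import Mathlib
import HarnessLib
import Summits.HubbardSuperconductivity.HubbardSuperconductivity.Theorems.KLProgrammeKLRegimeTwoCutoffScaleZeroSmall
import Summits.HubbardSuperconductivity.HubbardSuperconductivity.Theorems.KLProgrammeKLRegimeEngineV8DefsU4
import Summits.HubbardSuperconductivity.HubbardSuperconductivity.Theorems.KLProgrammeKLRegimeEngineV8DefsQ5
import Literature.MathematicalPhysics.QuantumLattice.MatsubaraDyadicChaining

/-!
# Route `KLProgramme` — ENGINE child `KLRegimeEngineV16` (stmt-HubbardSuperconductivity-20236), `stub_twoLeg_scale0`, conjunct (E3f-AT)₀: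
# THE CUTOFF LEG `hcut` AT SCALE 0 (cell gate-hubbard-kl, seat hubbard-kl-k3c4-p2 g6; technique «Matsubara all-U route», route (C))

Sequel of `…TwoCutoffScaleZeroSmall` (every sub-dyadic step `M ≤ M″ ≤ 2M` above `2^{10}β²(L+1)²` costs `≤ β/(2^{60}√M)`).
`MatsubaraDyadicChaining.norm_sub_le_of_subdyadic_steps` gives, for ALL cutoffs `M₁ ≤ M₂` above `2^{10}(⌈|β|⌉₊+1)²(L+1)²`,
`|klLocalPart L M₁ … 0 θ − klLocalPart L M₂ … 0 θ| ≤ 1/L` (**`abs_klLocalPart_zero_sub_le_inv_of_cutoffs`**), and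
**`twoLeg_scale0_hcut_of_klEng`** is that statement under the binders of `stub_twoLeg_scale0` — the `hcut` hypothesis of
`…KLRegimeSplit.twoLegVolumeRateAT_of_nestedLegs` at `n = 0` with `a = 1` (`Mq` and the empty histories discarded by the assembler).
Proof only; no definitions; nothing about superconductivity is asserted.
-/

noncomputable section

namespace Summit.HubbardSuperconductivity.HubbardSuperconductivity.Theorems.TwoVolumeDefect

set_option linter.dupNamespace false -- summit = problem name (single-conjunct summit), D-0017

open Finset Literature.MathematicalPhysics.QuantumLattice Literature.Probability.LatticeModels GrassmannAlgebra
open Summit.HubbardSuperconductivity.HubbardSuperconductivity.Theorems.KLRegimeSplit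
open Summit.HubbardSuperconductivity.HubbardSuperconductivity.Theorems.KLProgrammeLegKernels
open Summit.HubbardSuperconductivity.HubbardSuperconductivity.Theorems.EngineV8

variable {L M M'' : ℕ} [NeZero L]

/-! ## §3 Chaining: every pair of cutoffs above the threshold -/

/-- **THE CUTOFF LEG AT SCALE 0**: for an admissible frame, `0 < U ≤ 2^{-128}/Rsq⁴`, `μ ∈ klWindowC`, `klBetaMin ≤ β ≤ L`, and ALL cutoffs
`M₁ ≤ M₂` with `2^{10}(⌈|β|⌉₊+1)²(L+1)² ≤ M₁`: `|klLocalPart L M₁ … 0 θ − klLocalPart L M₂ … 0 θ| ≤ 1/L`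
(sub-dyadic steps `≤ β/(2^{60}√M)` chained by `MatsubaraDyadicChaining.norm_sub_le_of_subdyadic_steps`, and `√M₁ ≥ 32β(L+1)`). -/
theorem abs_klLocalPart_zero_sub_le_inv_of_cutoffs {R : RenConsts} (hR : R.WF) {U : ℝ} (hU : 0 < U)
    (hUs : U ≤ 1 / ((2 : ℝ) ^ 128 * klEngRsq R ^ 4)) {Nsc : ℕ} {μ : ℝ} (hμ : μ ∈ klWindowC) {K : TrigPolyC4v}
    (hK : FrameOK R U Nsc μ K) {β : ℝ} (hβ : klBetaMin ≤ β) (hβL : β ≤ L)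
    {M₁ M₂ : ℕ} [NeZero M₁] [NeZero M₂] (hM₁ : 2 ^ 10 * (⌈|β|⌉₊ + 1) ^ 2 * (L + 1) ^ 2 ≤ M₁) (h12 : M₁ ≤ M₂) (θ : ℝ) :
    |klLocalPart L M₁ β U μ K 0 θ - klLocalPart L M₂ β U μ K 0 θ| ≤ 1 / (L : ℝ) := by
  classical
  have hβ128 : (128 : ℝ) ≤ β := by simpa [klBetaMin] using hβ
  have hβpos : 0 < β := by linarith
  have hL0 : (0 : ℝ) < L := by exact_mod_cast Nat.pos_of_ne_zero (NeZero.ne L)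
  -- the real form of the threshold
  have hM₁r : (2 : ℝ) ^ 10 * β ^ 2 * ((L : ℝ) + 1) ^ 2 ≤ M₁ := by
    have hceil : β ≤ (⌈|β|⌉₊ : ℝ) + 1 := by
      have h1 : |β| ≤ (⌈|β|⌉₊ : ℝ) := Nat.le_ceil (|β|)
      have h2 : β ≤ |β| := le_abs_self β
      linarith
    have h1 : (2 : ℝ) ^ 10 * β ^ 2 * ((L : ℝ) + 1) ^ 2 ≤ (2 : ℝ) ^ 10 * ((⌈|β|⌉₊ : ℝ) + 1) ^ 2 * ((L : ℝ) + 1) ^ 2 := by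
      gcongr
    refine h1.trans ?_
    exact_mod_cast hM₁
  -- the total function of the cutoff
  set f : ℕ → ℝ := fun m => if hm : m = 0 then 0 else (haveI : NeZero m := ⟨hm⟩; klLocalPart L m β U μ K 0 θ) with hf
  have hfM : ∀ (m : ℕ) [NeZero m], f m = klLocalPart L m β U μ K 0 θ := by
    intro m _
    rw [hf]; dsimp only; rw [dif_neg (NeZero.ne m)]
  have hstep : ∀ m m' : ℕ, M₁ ≤ m → m ≤ m' → m' ≤ 2 * m → ‖f m' - f m‖ ≤ β / (2 : ℝ) ^ 60 / Real.sqrt m := by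
    intro m m' hm hmm' hm'
    have hm0 : m ≠ 0 := by
      intro h0; rw [h0] at hm; have := NeZero.ne M₁; omega
    have hm'0 : m' ≠ 0 := by omega
    haveI : NeZero m := ⟨hm0⟩
    haveI : NeZero m' := ⟨hm'0⟩
    rw [hfM m, hfM m', Real.norm_eq_abs, abs_sub_comm, div_div]
    have hmlow : (2 : ℝ) ^ 10 * β ^ 2 * ((L : ℝ) + 1) ^ 2 ≤ m := hM₁r.trans (by exact_mod_cast hm)
    exact abs_klLocalPart_zero_twoCutoff_sub_le_of_small hR hU hUs hμ hK hβ hβL hmlow hmm' hm' θ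
  have hM₁1 : 1 ≤ M₁ := Nat.one_le_iff_ne_zero.2 (NeZero.ne M₁)
  have hchain := norm_sub_le_of_subdyadic_steps f (c := β / (2 : ℝ) ^ 60) (by positivity) hstep M₁ M₂ le_rfl hM₁1 h12
  rw [hfM M₁, hfM M₂, Real.norm_eq_abs, abs_sub_comm] at hchain
  refine hchain.trans ?_
  -- `(2+√2)·β/2^60/√M₁ ≤ 1/L`
  have hsqM : 32 * β * ((L : ℝ) + 1) ≤ Real.sqrt M₁ := by
    rw [show 32 * β * ((L : ℝ) + 1) = Real.sqrt ((32 * β * ((L : ℝ) + 1)) ^ 2) by rw [Real.sqrt_sq (by positivity)]]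
    exact Real.sqrt_le_sqrt (by nlinarith)
  have hsq2 : Real.sqrt 2 ≤ 2 := by
    rw [show (2 : ℝ) = Real.sqrt (2 ^ 2) by rw [Real.sqrt_sq (by norm_num)]]
    exact Real.sqrt_le_sqrt (by norm_num)
  have hsqM0 : 0 < Real.sqrt M₁ := by
    refine Real.sqrt_pos.2 ?_; exact_mod_cast Nat.pos_of_ne_zero (NeZero.ne M₁)
  rw [div_le_div_iff₀ hsqM0 hL0]
  have hβ60 : 0 ≤ β / (2 : ℝ) ^ 60 := by positivity
  calc (2 + Real.sqrt 2) * (β / (2 : ℝ) ^ 60) * (L : ℝ) ≤ 4 * (β / (2 : ℝ) ^ 60) * ((L : ℝ) + 1) :=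
        mul_le_mul (mul_le_mul_of_nonneg_right (by linarith) hβ60) (by linarith) hL0.le (by positivity)
    _ ≤ 1 * (32 * β * ((L : ℝ) + 1)) := by
        rw [show 4 * (β / (2 : ℝ) ^ 60) * ((L : ℝ) + 1) = (4 / (32 * (2 : ℝ) ^ 60)) * (32 * β * ((L : ℝ) + 1)) by ring]
        exact mul_le_mul_of_nonneg_right (by norm_num) (by positivity)
    _ ≤ 1 * Real.sqrt M₁ := by gcongr

/-! ## §4 The `hcut` hypothesis of `twoLegVolumeRateAT_of_nestedLegs` at `n = 0`, under the binders of `stub_twoLeg_scale0` -/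

omit [NeZero L] in
/-- **THE CUTOFF LEG OF (E3f-AT)₀ UNDER THE ENGINE'S BINDERS** (`a = 1`): for `P.WF`, `R.WF2`, `μ ∈ klWindowC`, `0 < U ≤ klEngU₀4 P R c`,
`klBetaMin ≤ β`, an admissible frame (`FrameOKDeg R U (nScales β) μ K`), `klEngL₃ β U ≤ L`: for every `L₁ ≥ L`, all cutoffs
`M₂ ≥ M₁ ≥ (klEngQ5 P R).M0 β L₁` and every angle, `|klLocalPart L₁ M₁ … 0 θ − klLocalPart L₁ M₂ … 0 θ| ≤ 1/L₁`.  The assembler reads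
this as `hcut` of `…KLRegimeSplit.twoLegVolumeRateAT_of_nestedLegs` (n = 0, a = 1 ≤ Q.CL β 0/4) by discarding `Mq` and the (empty) histories. -/
theorem twoLeg_scale0_hcut_of_klEng (P : SplitConsts) {R : RenConsts} (hR : R.WF2) (c : ℝ) {μ : ℝ} (hμ : μ ∈ klWindowC) {U : ℝ}
    (hU : 0 < U) (hU₀ : U ≤ klEngU₀4 P R c) {β : ℝ} (hβ : klBetaMin ≤ β) {K : TrigPolyC4v} (hK : FrameOKDeg R U (nScales β) μ K)
    (hL : klEngL₃ β U ≤ L) (L₁ M₁ M₂ : ℕ) [NeZero L₁] [NeZero M₁] [NeZero M₂] (hLL₁ : L ≤ L₁)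
    (hM₁ : (klEngQ5 P R).M0 β L₁ ≤ M₁) (h12 : M₁ ≤ M₂) (θ : ℝ) :
    |klLocalPart L₁ M₁ β U μ K 0 θ - klLocalPart L₁ M₂ β U μ K 0 θ| ≤ 1 / (L₁ : ℝ) := by
  have hβ128 : (128 : ℝ) ≤ β := by simpa [klBetaMin] using hβ
  have hβpos : 0 < β := by linarith
  -- `U ≤ 2^-128/Rsq⁴`
  have hUs : U ≤ 1 / ((2 : ℝ) ^ 128 * klEngRsq R ^ 4) := by
    refine hU₀.trans ?_
    rw [klEngU₀4]
    have hRpos : 0 < klEngRsq R := lt_of_lt_of_le one_pos (one_le_klEngRsq R)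
    refine one_div_le_one_div_of_le (by positivity) ?_
    have hP : (1 : ℝ) ≤ klEngPsq P ^ 4 := one_le_pow₀ (one_le_klEngPsq P)
    have hc2 : (1 : ℝ) ≤ c ^ 2 + 1 := by nlinarith [sq_nonneg c]
    have hR0 : 0 ≤ klEngRsq R ^ 4 := by positivity
    calc (2 : ℝ) ^ 128 * klEngRsq R ^ 4 = (2 : ℝ) ^ 128 * 1 * klEngRsq R ^ 4 * 1 := by ring
      _ ≤ (2 : ℝ) ^ 128 * klEngPsq P ^ 4 * klEngRsq R ^ 4 * (c ^ 2 + 1) := by gcongr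
  -- `β ≤ L₁` from `klEngL₃ β U ≤ L ≤ L₁`
  have hβL₁ : β ≤ (L₁ : ℝ) := by
    have hL3 : (klEngL₃ β U : ℝ) ≤ L₁ := by exact_mod_cast hL.trans hLL₁
    refine le_trans ?_ hL3
    rw [klEngL₃]
    push_cast
    have hceil : β ≤ (⌈|β|⌉₊ : ℝ) + 1 := by
      have h1 : |β| ≤ (⌈|β|⌉₊ : ℝ) := Nat.le_ceil (|β|)
      have h2 : β ≤ |β| := le_abs_self β
      linarith
    have h1 : (1 : ℝ) ≤ ((⌈|U|⁻¹⌉₊ : ℝ) + 1) ^ 2 := by nlinarith [Nat.cast_nonneg (α := ℝ) ⌈|U|⁻¹⌉₊]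
    have hb1 : (1 : ℝ) ≤ (⌈|β|⌉₊ : ℝ) + 1 := by linarith [Nat.cast_nonneg (α := ℝ) ⌈|β|⌉₊]
    nlinarith [mul_le_mul hceil hb1 (by norm_num) (by positivity)]
  have hM₁' : 2 ^ 10 * (⌈|β|⌉₊ + 1) ^ 2 * (L₁ + 1) ^ 2 ≤ M₁ := by
    have : (klEngQ5 P R).M0 β L₁ = 2 ^ 10 * (⌈|β|⌉₊ + 1) ^ 2 * (L₁ + 1) ^ 2 := rfl
    rw [this] at hM₁; exact hM₁
  exact abs_klLocalPart_zero_sub_le_inv_of_cutoffs hR.wf hU hUs hμ hK.1 hβ hβL₁ hM₁' h12 θ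

end Summit.HubbardSuperconductivity.HubbardSuperconductivity.Theorems.TwoVolumeDefect

end
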